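import Summits.CriticalPhenomena.Ising3DConformalLimit.Theses.MonotoneBlocking
import Summits.CriticalPhenomena.Ising3DConformalLimit.Theorems.InversionUpgradeNormalised.Negative.RedundantHypotheses
import Summits.CriticalPhenomena.Ising3DConformalLimit.Theorems.InversionUpgradeNormalised.Negative.AutomaticOrders
import Summits.CriticalPhenomena.Ising3DConformalLimit.Theorems.MoebiusLimitExists.Negative.TwoPointPositivity
import Literature.Probability.LatticeModels.HighDimPointwiseTriviality

/-!
# `LimitsAreConformal` (item stmt-CriticalPhenomena-6154): non-degeneracy is load-bearing — unconditionally

Negative / structural knowledge about the crux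
`Summit.CriticalPhenomena.Ising3DConformalLimit.Theses.MonotoneBlocking.LimitsAreConformal`
(shared VERBATIM with `…Theses.MirrorHoelderCompactness.LimitsAreConformal`, tree
`LimitsAreConformalSplit.monotoneBlocking_iff_mirror`), standing crux disprover, cycle 1 (D-0016);
THEOREM-ONLY. Hypotheses on `(ρ, Δ, S)`: (H1) `ρ > 0` on `(0,1]`;
(H2) `HasPointwiseScalingLimit (criticalCorr 3) ρ S`; (H3) `S = 0` off `NonCoincident`;
(H4) `IsNondegenerateTwoPoint S`; (H5) `IsTranslationInvariant S`; (H6) `IsScaleCovariant Δ S`;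
conclusion (i) `IsRotationInvariant S` ∧ (ii) `IsInversionCovariant Δ S` ∧ (iii) `HasNontrivialU4 S`.

* `limitsAreConformal_false_without_nondegeneracy`: (H4) is LOAD-BEARING, **unconditionally** — the
  degenerate renormalisation `ρ δ = δ` sends the critical correlators to the TRIVIAL FAMILY
  `(1,0,0,…) = fun n _ => if n = 0 then 1 else 0`, a GENUINE pointwise limit of `criticalCorr 3`
  (`hasPointwiseScalingLimit_trivial`) having (H1)(H2)(H3)(H5)(H6), (i), (ii) and `U₄ ≡ 0`.
  Contrast: for the sibling cruxes 1982 (= conjunct (ii)) and 8367 (rotations) (H4) is REDUNDANT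
  (`InversionUpgradeNormalisedNegative.crux_iff_withoutNondegeneracy`).
* `eq_trivial_of_degenerate`: under (H2)+(H3) alone, EVERY degenerate instance IS the trivial family
  (MMS positivity propagation, Griffiths I + Lebowitz in the limit, Aizenman–Newman Wick dichotomy,
  `m*(β_c) = 0`); hence `limitsAreConformal_iff_split_nondegeneracy`: (H4) matters ONLY for clause
  (iii) — clauses (i),(ii) hold with (H4) deleted iff they hold with it.

Companion: `Negative/LoadBearingHypotheses.lean` ((H1)(H2)(H3)(H5)(H6), conclusion audit, `d ≥ 5`).
No definitions: the trivial family is written out as the lambda `fun n _ => if n = 0 then 1 else 0`.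
-/

noncomputable section

namespace Summit.CriticalPhenomena.Ising3DConformalLimit.LimitsAreConformalNegative

open Literature.Probability.LatticeModels
open Filter Set Function EuclideanGeometry
open scoped Topology
open Summit.CriticalPhenomena.Ising3DConformalLimit.Theses
open Summit.CriticalPhenomena.Ising3DConformalLimit.RotationUpgradeFromTwoPointNegative
  (criticalCorr_nonneg pairingSum_zero_kernel)
open Summit.CriticalPhenomena.Ising3DConformalLimit.InversionUpgradeNormalisedNegative
  (limit_zero_eq_one limit_odd_eq_zero)
open Summit.CriticalPhenomena.Ising3DConformalLimit.MoebiusLimitExistsNegative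
  (limit_two_nonneg isNondegenerateTwoPoint_iff_exists_pos)

/-! ## The trivial family `(1, 0, 0, …)` is a genuine pointwise limit of the critical correlators -/

/-- `ρ δ = δ` renormalises the critical correlators to the trivial family `(1,0,0,…)`: a GENUINE
pointwise scaling limit of `criticalCorr 3` (`|⟨∏σ⟩| ≤ 1`, so `|δⁿ⟨∏σ⟩| ≤ δ → 0` uniformly for
`n ≥ 1`; the arity-`0` rescaled correlator is the constant `1`). [folklore] -/
theorem hasPointwiseScalingLimit_trivial :
    HasPointwiseScalingLimit (criticalCorr 3) (fun δ => δ)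
      ((fun n _ => if n = 0 then 1 else 0) : CorrFamily 3) := by
  intro n
  rcases Nat.eq_zero_or_pos n with rfl | hn
  · refine TendstoUniformlyOn.tendstoLocallyUniformlyOn (Metric.tendstoUniformlyOn_iff.2 ?_)
    intro ε hε
    refine Filter.Eventually.of_forall fun δ x _ => ?_
    rw [Summit.CriticalPhenomena.Ising3DConformalLimit.Theorems.MoebiusLimitOfTwoPointLaw.Negative.rescaledCorrelator_arity_zero]
    simp [hε]
  · refine TendstoUniformlyOn.tendstoLocallyUniformlyOn (Metric.tendstoUniformlyOn_iff.2 ?_)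
    intro ε hε
    have hm : Set.Ioo (0:ℝ) (min 1 ε) ∈ 𝓝[>] (0:ℝ) := Ioo_mem_nhdsGT (lt_min one_pos hε)
    filter_upwards [hm] with δ hδ x _
    have hn0 : n ≠ 0 := hn.ne'
    simp only [if_neg hn0, rescaledCorrelator_apply, Real.dist_eq, zero_sub, abs_neg,
      abs_mul, abs_pow, abs_of_pos hδ.1]
    have h1 : |criticalCorr 3 n fun i => latticeApprox δ (x i)| ≤ 1 := abs_criticalCorr_le_one le_rfl _ _
    have hδ1 : δ < 1 := hδ.2.trans_le (min_le_left _ _)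
    have hδε : δ < ε := hδ.2.trans_le (min_le_right _ _)
    calc δ ^ n * |criticalCorr 3 n fun i => latticeApprox δ (x i)| ≤ δ ^ n * 1 :=
          mul_le_mul_of_nonneg_left h1 (pow_nonneg hδ.1.le n)
      _ ≤ δ ^ 1 * 1 := by
          refine mul_le_mul_of_nonneg_right (pow_le_pow_of_le_one hδ.1.le hδ1.le hn) zero_le_one
      _ < ε := by simpa using hδε

/-- The trivial family is normalised (arity `0` has no coincident configurations). [folklore] -/
theorem trivial_normalised (n : ℕ) (z : Fin n → EuclideanSpace ℝ (Fin 3))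
    (hz : z ∉ NonCoincident 3 n) :
    ((fun n _ => if n = 0 then 1 else 0) : CorrFamily 3) n z = 0 := by
  rcases Nat.eq_zero_or_pos n with rfl | hn
  · exact absurd ((mem_nonCoincident z).2 fun i => i.elim0) hz
  · simp [hn.ne']

/-- The trivial family is translation invariant. [folklore] -/
theorem trivial_isTranslationInvariant :
    IsTranslationInvariant ((fun n _ => if n = 0 then 1 else 0) : CorrFamily 3) := fun _ _ _ => rfl

/-- The trivial family is `O(3)` invariant. [folklore] -/
theorem trivial_isRotationInvariant :
    IsRotationInvariant ((fun n _ => if n = 0 then 1 else 0) : CorrFamily 3) := fun _ _ _ => rfl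

/-- The trivial family is scale covariant with EVERY weight. [folklore] -/
theorem trivial_isScaleCovariant (Δ : ℝ) :
    IsScaleCovariant Δ ((fun n _ => if n = 0 then 1 else 0) : CorrFamily 3) := by
  intro n c _ x
  rcases Nat.eq_zero_or_pos n with rfl | hn
  · simp
  · simp [hn.ne']

/-- The trivial family is inversion covariant with EVERY weight. [folklore] -/
theorem trivial_isInversionCovariant (Δ : ℝ) :
    IsInversionCovariant Δ ((fun n _ => if n = 0 then 1 else 0) : CorrFamily 3) := by
  intro n x _
  rcases Nat.eq_zero_or_pos n with rfl | hn
  · simp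
  · simp [hn.ne']

/-- The trivial family is degenerate. [folklore] -/
theorem not_isNondegenerateTwoPoint_trivial :
    ¬ IsNondegenerateTwoPoint ((fun n _ => if n = 0 then 1 else 0) : CorrFamily 3) := fun h =>
  (h _ (zero_unitVec_mem_nonCoincident one_ne_zero)).ne' (by simp)

/-- The trivial family is Gaussian (`U₄ ≡ 0`). [folklore] -/
theorem not_hasNontrivialU4_trivial :
    ¬ HasNontrivialU4 ((fun n _ => if n = 0 then 1 else 0) : CorrFamily 3) := by
  rintro ⟨x, -, hne⟩
  exact hne (by simp [limitConnectedFour])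

/-! ## (H4) is load-bearing — unconditionally -/

/-- **(H4) is load-bearing, unconditionally**: the crux with `IsNondegenerateTwoPoint S` DELETED is
false. Witness `ρ δ = δ`, `S = (1,0,0,…)`, `Δ = 1/2`: all other hypotheses hold, (i) and (ii) hold,
(iii) fails. Any proof must use `S₂ > 0` — and by `limitsAreConformal_iff_split_nondegeneracy` only
for (iii). [folklore] -/
theorem limitsAreConformal_false_without_nondegeneracy :
    ¬ ∀ (ρ : ℝ → ℝ) (Δ : ℝ) (S : CorrFamily 3), (∀ δ ∈ Set.Ioc (0:ℝ) 1, 0 < ρ δ) →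
        HasPointwiseScalingLimit (criticalCorr 3) ρ S → (∀ n z, z ∉ NonCoincident 3 n → S n z = 0) →
        IsTranslationInvariant S → IsScaleCovariant Δ S →
        IsRotationInvariant S ∧ IsInversionCovariant Δ S ∧ HasNontrivialU4 S := fun h =>
  not_hasNontrivialU4_trivial (h (fun δ => δ) (1 / 2) _ (fun _ hδ => hδ.1)
    hasPointwiseScalingLimit_trivial trivial_normalised trivial_isTranslationInvariant
    (trivial_isScaleCovariant _)).2.2

/-! ## Every degenerate instance is the trivial family -/

/-- Griffiths I in the limit at order `4`, for ANY renormalisation (even power). [cite: FriedliVelenik2017, Thm. 3.20] -/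
theorem limit_four_nonneg {ρ : ℝ → ℝ} {S : CorrFamily 3}
    (hlim : HasPointwiseScalingLimit (criticalCorr 3) ρ S) {x : Fin 4 → EuclideanSpace ℝ (Fin 3)}
    (hx : x ∈ NonCoincident 3 4) : 0 ≤ S 4 x := by
  refine ge_of_tendsto' ((hlim 4).tendsto_at hx) fun δ => ?_
  rw [rescaledCorrelator_apply]
  have h4 : 0 ≤ ρ δ ^ 4 := by positivity
  exact mul_nonneg h4 (criticalCorr_nonneg _)

/-- **Every degenerate instance IS the trivial family** (no symmetry hypothesis and no sign of `ρ`
needed): under (H2)+(H3), `¬` (H4) forces `S = (1,0,0,…)`. Positivity of `S₂` at one pair propagates to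
all pairs (`isNondegenerateTwoPoint_iff_exists_pos`, Messager–Miracle-Solé + self-similarity of
full-filter limits), so `S₂ ≡ 0`; then `0 ≤ S₄ ≤ ΣS₂S₂ = 0` (Griffiths I, Lebowitz in the limit), and
the Aizenman–Newman Wick dichotomy (`eq_pairingSum_of_limitConnectedFour_eq_zero`) kills all even
orders; odd orders vanish (`m*(β_c) = 0`), `S₀ ≡ 1`. [cite: AizenmanCDM2020, §7, Prop. 7.2] -/
theorem eq_trivial_of_degenerate {ρ : ℝ → ℝ} {S : CorrFamily 3}
    (hlim : HasPointwiseScalingLimit (criticalCorr 3) ρ S)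
    (hnorm : ∀ n z, z ∉ NonCoincident 3 n → S n z = 0) (hdeg : ¬ IsNondegenerateTwoPoint S) :
    S = fun n _ => if n = 0 then 1 else 0 := by
  have h2 : ∀ y, S 2 y = 0 := by
    intro y
    by_cases hy : y ∈ NonCoincident 3 2
    · refine le_antisymm ?_ (limit_two_nonneg hlim hy)
      by_contra hlt
      push Not at hlt
      exact hdeg ((isNondegenerateTwoPoint_iff_exists_pos hlim).2 ⟨y, hy, hlt⟩)
    · exact hnorm 2 y hy
  have hU : ∀ z ∈ NonCoincident 3 4, limitConnectedFour S z = 0 := by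
    intro z hz
    have hle := limitConnectedFour_nonpos_of_hasPointwiseScalingLimit (by norm_num) hlim hz
    have hge : 0 ≤ S 4 z := limit_four_nonneg hlim hz
    simp only [limitConnectedFour, h2, mul_zero, add_zero, sub_zero] at hle ⊢
    exact le_antisymm hle hge
  funext n x
  rcases Nat.even_or_odd n with hev | hodd
  · obtain ⟨m, rfl⟩ : ∃ m, n = 2 * m := by
      obtain ⟨r, hr⟩ := hev
      exact ⟨r, by omega⟩
    rcases Nat.lt_or_ge m 2 with hm | hm
    · interval_cases m
      · show S 0 x = 1
        exact limit_zero_eq_one hlim x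
      · show S 2 x = if 2 = 0 then 1 else 0
        simp [h2 x]
    · have htriv : (if 2 * m = 0 then (1:ℝ) else 0) = 0 := by
        have : 2 * m ≠ 0 := by omega
        simp [this]
      rw [htriv]
      by_cases hx : x ∈ NonCoincident 3 (2 * m)
      · rw [hlim.eq_pairingSum_of_limitConnectedFour_eq_zero (by norm_num) hU hm hx]
        have hk : (fun p q : EuclideanSpace ℝ (Fin 3) => S 2 ![p, q]) = fun _ _ => (0:ℝ) := by
          funext p q; exact h2 _
        rw [hk]
        exact pairingSum_zero_kernel (by omega) x
      · exact hnorm _ x hx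
  · have htriv : (if n = 0 then (1:ℝ) else 0) = 0 := by
      have : n ≠ 0 := by rintro rfl; exact absurd hodd (by decide)
      simp [this]
    rw [htriv]
    exact limit_odd_eq_zero hlim hnorm hodd x

/-- Degenerate instances satisfy (i) and (ii) (with every weight) and violate (iii). [folklore] -/
theorem degenerate_clauses {ρ : ℝ → ℝ} (Δ : ℝ) {S : CorrFamily 3}
    (hlim : HasPointwiseScalingLimit (criticalCorr 3) ρ S)
    (hnorm : ∀ n z, z ∉ NonCoincident 3 n → S n z = 0) (hdeg : ¬ IsNondegenerateTwoPoint S) :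
    IsRotationInvariant S ∧ IsInversionCovariant Δ S ∧ ¬ HasNontrivialU4 S := by
  obtain rfl := eq_trivial_of_degenerate hlim hnorm hdeg
  exact ⟨trivial_isRotationInvariant, trivial_isInversionCovariant Δ, not_hasNontrivialU4_trivial⟩

/-- So **no degenerate instance of (H1)(H2)(H3)(H5)(H6) has (iii)**, and every one has (i),(ii): the
set of counterexamples to the crux-without-(H4) is exactly the set of degenerate renormalisations.
[folklore] -/
theorem withoutNondegeneracy_counterexample_iff {ρ : ℝ → ℝ} {Δ : ℝ} {S : CorrFamily 3}
    (hlim : HasPointwiseScalingLimit (criticalCorr 3) ρ S)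
    (hnorm : ∀ n z, z ∉ NonCoincident 3 n → S n z = 0)
    (hcrux : MonotoneBlocking.LimitsAreConformal) (hρ : ∀ δ ∈ Set.Ioc (0:ℝ) 1, 0 < ρ δ)
    (htr : IsTranslationInvariant S) (hsc : IsScaleCovariant Δ S) :
    ¬ (IsRotationInvariant S ∧ IsInversionCovariant Δ S ∧ HasNontrivialU4 S) ↔
      ¬ IsNondegenerateTwoPoint S := by
  constructor
  · intro h hnd
    exact h (hcrux ρ Δ S hρ hlim hnorm hnd htr hsc)
  · intro hdeg h
    exact (degenerate_clauses Δ hlim hnorm hdeg).2.2 h.2.2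

/-- **(H4) is load-bearing ONLY through clause (iii).** The crux is equivalent to the conjunction of
"clauses (i),(ii) WITHOUT the non-degeneracy hypothesis" and "clause (iii) with it". So a prover of
(i)/(ii) may ignore (H4) (as the sibling disprovers of 8367/1982 found), a prover of (iii) may not.
[folklore] -/
theorem limitsAreConformal_iff_split_nondegeneracy :
    MonotoneBlocking.LimitsAreConformal ↔
      (∀ (ρ : ℝ → ℝ) (Δ : ℝ) (S : CorrFamily 3), (∀ δ ∈ Set.Ioc (0:ℝ) 1, 0 < ρ δ) →
        HasPointwiseScalingLimit (criticalCorr 3) ρ S → (∀ n z, z ∉ NonCoincident 3 n → S n z = 0) →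
        IsTranslationInvariant S → IsScaleCovariant Δ S →
        IsRotationInvariant S ∧ IsInversionCovariant Δ S) ∧
      (∀ (ρ : ℝ → ℝ) (Δ : ℝ) (S : CorrFamily 3), (∀ δ ∈ Set.Ioc (0:ℝ) 1, 0 < ρ δ) →
        HasPointwiseScalingLimit (criticalCorr 3) ρ S → (∀ n z, z ∉ NonCoincident 3 n → S n z = 0) →
        IsNondegenerateTwoPoint S → IsTranslationInvariant S → IsScaleCovariant Δ S →
        HasNontrivialU4 S) := by
  constructor
  · intro h
    refine ⟨fun ρ Δ S h1 h2 h3 h5 h6 => ?_,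
      fun ρ Δ S h1 h2 h3 h4 h5 h6 => (h ρ Δ S h1 h2 h3 h4 h5 h6).2.2⟩
    by_cases h4 : IsNondegenerateTwoPoint S
    · exact ⟨(h ρ Δ S h1 h2 h3 h4 h5 h6).1, (h ρ Δ S h1 h2 h3 h4 h5 h6).2.1⟩
    · have hc := degenerate_clauses Δ h2 h3 h4
      exact ⟨hc.1, hc.2.1⟩
  · rintro ⟨hA, hB⟩ ρ Δ S h1 h2 h3 h4 h5 h6
    exact ⟨(hA ρ Δ S h1 h2 h3 h5 h6).1, (hA ρ Δ S h1 h2 h3 h5 h6).2, hB ρ Δ S h1 h2 h3 h4 h5 h6⟩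

end Summit.CriticalPhenomena.Ising3DConformalLimit.LimitsAreConformalNegative

end
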